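import Literature.AnabelianGeometry.SemiGraphs.TemperedBranchDoubleFold
import Literature.AnabelianGeometry.SemiGraphs.WitnessIwahoriDouble
import Literature.AnabelianGeometry.SemiGraphs.TemperedCompactInVerticialWitnessLoop
import Literature.AnabelianGeometry.SemiGraphs.TemperedReconstructionCor39FactsFinite
import HarnessLib

/-!
# [SemiAnbd] Corollary 3.9 under the LITERAL reading of Definition 3.8 is FALSE as typed (the "fold")

Mochizuki, *Semi-graphs of anabelioids*, Publ. RIMS **42** (2006), §3, Definition 3.8 and Corollary 3.9,
manuscript p. 42 [cite: MochizukiSemiAnbd2006, Cor 3.9 p.42].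

PROOF-ONLY file (0 defs) of the abc-iut cell (layer L3, F wave seat abc-iut-f-175; FACT-LIST row F-1710
`ProfiniteSemiGraph.Cor39`, STRIKE-if-refuted).  Cell finding t2g2-F1 / ruling χ2 (abc-iut-L3-t2,
abc-iut-L3-lead, 2026-08-25): the tree's frozen `IsQuasiGeometric` renders Def. 3.8 LITERALLY — in the
"respectively" clause the pair `K₂, H₂` of distinct maximal compact subgroups of `Π₂` is not tied to the
images of `K₁`, `H₁` — and under that reading "the fold homomorphism `Π_{v₁} *_{Π_e} Π_{v₂} → Π_w ⊂
π₁^temp(H)` … is quasi-geometric but is induced by NO morphism of semi-graphs".  This file kernel-checks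
the finding on the witness pair `(𝒟₁, 𝒢₁)` — abc-iut-w5-d236's estranged loop `𝒢₁ = loopGraph p` and its
double `𝒟₁ = doubleLoop p` along the torus branch (`WitnessIwahoriDouble`), both satisfying
`Cor39Hypotheses` — with the fold `φ : π₁^temp(𝒟₁) → π₁^temp(𝒢₁)` of `TemperedBranchDoubleFold`:

* `fold_isQuasiGeometric` — `φ` is quasi-geometric in the LITERAL sense: it maps every verticial subgroup
  ONTO a verticial subgroup at `w` and every edge-like subgroup ONTO an edge-like subgroup of the loop,
  and those are maximal compact subgroups, resp. nontrivial intersections of two distinct ones, by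
  Thm. 3.7 (iv) at the two FINITE graphs (`maximalCompactIffVerticialAt_of_finiteGraph`, abc-iut-L3-t8);
* `fold_not_compatV` — NO locally open morphism `F : 𝒟₁ → 𝒢₁` is compatible with `φ` on verticial
  homomorphisms: compatibility and Thm. 3.7 (i)/(ii) force `F_{v} = Inn(d)` at the vertex `v` whose branch
  `F` sends to the twisted branch, and then the 2-cell of `F` at that branch puts the torus `T₀` inside a
  conjugate of the twisted complement `T₁` — against the estrangement of the loop;
* hence `not_quasiGeometricGraphData : ¬ QuasiGeometricGraphData.{0}` (the literal step (R2)) and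
  `not_cor39 : ¬ Cor39.{0}` (clause (b) with (R1) `InducesCompatible_holds`).

HONEST FRAMING.  What is refuted is OUR literal typing of Def. 3.8 inside `Cor39` (open-as-typed since
ruling χ2); the compatible reading — presumably the intended one — is the tree's `Cor39Compat` /
`Cor39CompatUpToTwist`, the latter a THEOREM for finite graphs (`cor39CompatUpToTwistAt_of_finite`,
abc-iut-w4-d064).  Nothing here refutes [SemiAnbd] Cor. 3.9 as printed, and nothing takes a side on
[IUTchIII] Cor. 3.12.
-/

noncomputable section

namespace Literature.AnabelianGeometry.SemiGraphs

namespace IwahoriWitness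

open ProfiniteSemiGraph

variable (p : ℕ) [Fact p.Prime]

/-- Equality of the image with the target gives "maps surjectively onto an open subgroup of".
[cite: MochizukiSemiAnbd2006, Def 3.8 p.42] -/
private theorem mapsOnto_of_map_eq {G H : Type} [Group G] [Group H] [TopologicalSpace H] (f : G →* H)
    {K₁ : Subgroup G} {K₂ : Subgroup H} (h : K₁.map f = K₂) : MapsOntoOpenSubgroupOf f K₁ K₂ := by
  refine ⟨h.le, ?_⟩
  have : (Subtype.val : K₂ → H) ⁻¹' ((K₁.map f : Subgroup H) : Set H) = Set.univ :=
    Set.eq_univ_of_forall fun x => by rw [h]; exact x.2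
  rw [this]
  exact isOpen_univ

/-- **The fold is quasi-geometric in the LITERAL sense of Def. 3.8** (`IsQuasiGeometric`): for any charts
and any `φ : π₁^temp(𝒟₁) → π₁^temp(𝒢₁)` representing the fold functor, every maximal compact subgroup of
`π₁^temp(𝒟₁)` (= verticial, Thm. 3.7 (iv) at the finite `𝒟₁`) maps ONTO a verticial subgroup at `w`
(maximal compact, (iv) at `𝒢₁`), and every nontrivial intersection of two distinct maximal compact
subgroups (= edge-like) maps ONTO an edge-like subgroup of the loop, which is a nontrivial intersection of
two distinct maximal compact subgroups ((iv) at `𝒢₁`). [cite: MochizukiSemiAnbd2006, Def 3.8 p.42] -/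
theorem fold_isQuasiGeometric (cD : TemperedPiChart (doubleLoop p)) (cL : TemperedPiChart (loopGraph p))
    (φ : cD.G →ₜ* cL.G) (hφ : Nonempty (foldChartPullback (torusBranch_abuts p) cD cL ≅ BTemp.res φ)) :
    IsQuasiGeometric φ := by
  have h37D := doubleLoop_thm37Hypotheses p
  have h37L := loopGraph_thm37Hypotheses p
  obtain ⟨hmaxD, hintD⟩ := maximalCompactIffVerticialAt_of_finiteGraph (𝒢 := doubleLoop p) h37D cD
  obtain ⟨hmaxL, hintL⟩ := maximalCompactIffVerticialAt_loopGraph p h37L cL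
  obtain ⟨⟨_, ψ, hψ, rfl⟩, hinjL⟩ := verticialInjective_holds (loopGraph p) h37L cL PUnit.unit
  refine ⟨fun K₁ hK₁ => ?_, fun K₁ H₁ hK₁ hH₁ hne hnt => ?_⟩
  · -- maximal compact subgroups: verticial ↦ verticial at `w`
    obtain ⟨v, ψ', hψ', rfl⟩ := (hmaxD K₁).mp hK₁
    obtain ⟨g, hg⟩ := fold_conj_verticial (torusBranch_abuts p) cD cL φ hφ v ψ' ψ hψ' hψ
    have himg : ψ'.toMonoidHom.range.map φ.toMonoidHom =
        ψ.toMonoidHom.range.map (MulAut.conj g).toMonoidHom := by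
      rw [MonoidHom.map_range]
      exact range_eq_map_conj_of_conj_eq cL ψ (φ.comp ψ') g fun a => (hg a).symm
    exact ⟨_, (hmaxL _).mpr ⟨PUnit.unit, conj_mem_verticialSubgroups cL ⟨ψ, hψ, rfl⟩ g⟩,
      mapsOnto_of_map_eq φ.toMonoidHom himg⟩
  · -- nontrivial intersections of two distinct maximal compact subgroups: edge-like ↦ edge-like
    obtain ⟨e, -, ψe, hψe, hLeq⟩ := (hintD (K₁ ⊓ H₁) hnt).mp ⟨K₁, H₁, hK₁, hH₁, hne, rfl⟩
    obtain ⟨g, hg⟩ := fold_conj_edge (torusBranch_abuts p) cD cL φ hφ e ψe ψ hψe hψ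
    have hbr : IsEdgeHom cL ((loopGraph p).graph.edgeOf torusBranch)
        (ψ.comp ((loopGraph p).brHom torusBranch PUnit.unit (torusBranch_abuts p))) :=
      isEdgeHom_comp_brHom cL (torusBranch_abuts p) hψ
    have hE : ((ψ.comp ((loopGraph p).brHom torusBranch PUnit.unit (torusBranch_abuts p))).toMonoidHom.range).map
          (MulAut.conj g).toMonoidHom ∈ edgeLikeSubgroups cL ((loopGraph p).graph.edgeOf torusBranch) :=
      conj_mem_edgeLikeSubgroups' cL ⟨_, hbr, rfl⟩ g
    have himg : (K₁ ⊓ H₁).map φ.toMonoidHom =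
        ((ψ.comp ((loopGraph p).brHom torusBranch PUnit.unit (torusBranch_abuts p))).toMonoidHom.range).map
          (MulAut.conj g).toMonoidHom := by
      rw [hLeq, MonoidHom.map_range]
      exact range_eq_map_conj_of_conj_eq cL _ (φ.comp ψe) g fun a => (hg a).symm
    -- the image is nontrivial: `ψ ∘ b₀` is injective on the infinite `U`
    have hE0 : ((ψ.comp ((loopGraph p).brHom torusBranch PUnit.unit (torusBranch_abuts p))).toMonoidHom.range).map
        (MulAut.conj g).toMonoidHom ≠ ⊥ := by
      intro h0
      have h1 := (Subgroup.map_eq_bot_iff_of_injective _ (MulAut.conj g).injective).mp h0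
      obtain ⟨u, hu⟩ := exists_ne (1 : IwU p)
      have hmem : (ψ.comp ((loopGraph p).brHom torusBranch PUnit.unit (torusBranch_abuts p))) u ∈
          (ψ.comp ((loopGraph p).brHom torusBranch PUnit.unit (torusBranch_abuts p))).toMonoidHom.range :=
        ⟨u, rfl⟩
      rw [h1, Subgroup.mem_bot] at hmem
      have h2 : (loopGraph p).brHom torusBranch PUnit.unit (torusBranch_abuts p) u = 1 :=
        hinjL ψ hψ (hmem.trans (map_one ψ).symm)
      exact hu (loopGraph_isOfInjectiveType p torusBranch PUnit.unit (torusBranch_abuts p)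
        (h2.trans (map_one _).symm))
    obtain ⟨K₂, H₂, hK₂, hH₂, hne₂, hEeq⟩ := (hintL _ hE0).mpr
      ⟨_, isClosedEdge_of_isGraph (loopGraph_isGraph p) _, hE⟩
    refine ⟨K₂, H₂, hK₂, hH₂, hne₂, hEeq ▸ hE0, mapsOnto_of_map_eq φ.toMonoidHom (himg.trans hEeq)⟩

/-- Conjugation bookkeeping: `d a d⁻¹ = g z g⁻¹` puts `a` in the `d⁻¹g`-conjugate of any subgroup
containing `z`. [folklore] -/
private theorem mem_map_conj_of_eq {G : Type} [Group G] {S : Subgroup G} {a z d g : G} (hz : z ∈ S)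
    (h : d * a * d⁻¹ = g * z * g⁻¹) : a ∈ S.map (MulAut.conj (d⁻¹ * g)).toMonoidHom := by
  refine ⟨z, hz, ?_⟩
  rw [MulEquiv.coe_toMonoidHom, MulAut.conj_apply]
  have ha : a = d⁻¹ * (g * z * g⁻¹) * d := by rw [← h]; group
  rw [ha]
  group

/-- The group-theoretic end of the argument: if `T₀` meets no conjugate of `T₁` and contains an element
`≠ 1`, then no `d, g` can satisfy `d a d⁻¹ ∈ g T₁ g⁻¹` for all `a ∈ T₀`. [folklore] -/
private theorem estranged_tail {V : Type} [Group V] {T₀ T₁ : Subgroup V}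
    (hT : ∀ x : V, T₀ ⊓ T₁.map (MulAut.conj x).toMonoidHom = ⊥) (h0 : ∃ a ∈ T₀, a ≠ 1) {d g : V}
    (hcomm : ∀ a ∈ T₀, ∃ z ∈ T₁, d * a * d⁻¹ = g * z * g⁻¹) : False := by
  obtain ⟨a, ha, ha1⟩ := h0
  obtain ⟨z, hz, h⟩ := hcomm a ha
  have hmem : a ∈ (⊥ : Subgroup V) :=
    hT (d⁻¹ * g) ▸ Subgroup.mem_inf.mpr ⟨ha, mem_map_conj_of_eq hz h⟩
  exact ha1 (Subgroup.mem_bot.mp hmem)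

/-- **No locally open morphism `𝒟₁ → 𝒢₁` is compatible with the fold on verticial homomorphisms.**
Let `F` be locally open and compatible with `φ`.  Its underlying morphism of semi-graphs is injective on
the two branches of the edge of `𝒟₁`, so some branch `β` (at the vertex `v = β`) goes to the TWISTED
branch of the loop.  At `v`: `φ ∘ ψ_v` is conjugate to `ψ_w` (the fold) and to `ψ_w ∘ F_v` (compatibility),
so `ψ_w ∘ F_v = γ_δ ∘ ψ_w`; the image has finite index (`F` locally open, Thm. 3.7 (i)), so Thm. 3.7 (ii)
(`verticialDistinct_holds`, second clause) gives `δ ∈ ψ_w(Π_w)`, i.e. `F_v = Inn(d)` (`ψ_w` injective).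
The 2-cell of `F` at `β` then reads `d · b₀(u) · d⁻¹ = g · b₁(u') · g⁻¹`, so `T₀ ≤ (d⁻¹g) T₁ (d⁻¹g)⁻¹` —
contradicting `T₀ ∩ x T₁ x⁻¹ = 1` (the loop is estranged) since `T₀` is infinite.
[cite: MochizukiSemiAnbd2006, Cor 3.9 p.42] -/
theorem fold_not_compatV (cD : TemperedPiChart (doubleLoop p)) (cL : TemperedPiChart (loopGraph p))
    (φ : cD.G →ₜ* cL.G) (hφ : Nonempty (foldChartPullback (torusBranch_abuts p) cD cL ≅ BTemp.res φ))
    (F : Hom (doubleLoop p) (loopGraph p)) (hF : F.IsLocallyOpen) (hV : F.CompatV cD cL φ) : False := by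
  have h37D := doubleLoop_thm37Hypotheses p
  have h37L := loopGraph_thm37Hypotheses p
  -- a branch `β` of `𝒟₁` sent to the twisted branch (coefficient `1`)
  have hneb : F.base.branchMap ⟨true⟩ ≠ F.base.branchMap ⟨false⟩ := fun h => by
    cases F.base.branchMap_injOn ⟨true⟩ ⟨false⟩ rfl h
  obtain ⟨β, hβ1⟩ : ∃ β : (doubleLoop p).graph.Branch, coeff p (F.base.branchMap β) = 1 := by
    rcases coeff_pair_of_ne p hneb with ⟨-, h1⟩ | ⟨h1, -⟩
    · exact ⟨⟨true⟩, h1⟩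
    · exact ⟨⟨false⟩, h1⟩
  have hβne : F.base.branchMap β ≠ torusBranch := fun h => by
    rw [h, coeff_torusBranch] at hβ1
    exact zero_ne_one hβ1
  -- verticial homomorphisms at `v = β` and at `w`
  obtain ⟨⟨_, ψ', hψ', rfl⟩, -⟩ := verticialInjective_holds (doubleLoop p) h37D cD β
  obtain ⟨⟨_, ψ, hψ, rfl⟩, hinjL⟩ := verticialInjective_holds (loopGraph p) h37L cL PUnit.unit
  obtain ⟨γ, hγ⟩ := hV β ψ' ψ hψ' hψ
  obtain ⟨κ, hκ⟩ := fold_conj_verticial (torusBranch_abuts p) cD cL φ hφ β ψ' ψ hψ' hψ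
  -- `ψ ∘ F_v = γ_δ ∘ ψ` with `δ = γ⁻¹ κ`
  have hδ : ∀ x, ψ (F.hV β x) = γ⁻¹ * κ * ψ x * (γ⁻¹ * κ)⁻¹ := fun x => by
    have h1 : γ * ψ (F.hV β x) * γ⁻¹ = κ * ψ x * κ⁻¹ := (hγ x).symm.trans (hκ x)
    calc ψ (F.hV β x) = γ⁻¹ * (γ * ψ (F.hV β x) * γ⁻¹) * γ := by group
      _ = γ⁻¹ * (κ * ψ x * κ⁻¹) * γ := by rw [h1]
      _ = γ⁻¹ * κ * ψ x * (γ⁻¹ * κ)⁻¹ := by group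
  set δ : cL.G := γ⁻¹ * κ with hδdef
  -- the verticial subgroup `W = ψ(Π_w)` and its conjugate `W^δ = ψ(F_v(Π_v))`, of finite index in `W`
  have hWv : ψ.toMonoidHom.range ∈ verticialSubgroups cL PUnit.unit := ⟨ψ, hψ, rfl⟩
  have hWδ : ψ.toMonoidHom.range.map (MulAut.conj δ).toMonoidHom =
      (F.hV β).toMonoidHom.range.map ψ.toMonoidHom := by
    apply le_antisymm
    · rintro _ ⟨_, ⟨x, rfl⟩, rfl⟩
      exact ⟨F.hV β x, ⟨x, rfl⟩, hδ x⟩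
    · rintro _ ⟨_, ⟨x, rfl⟩, rfl⟩
      exact ⟨ψ x, ⟨x, rfl⟩, (hδ x).symm⟩
  have hU : (F.hV β).toMonoidHom.range.index ≠ 0 := by
    haveI := Subgroup.quotient_finite_of_isOpen (F.hV β).toMonoidHom.range (hF.1 β)
    exact Subgroup.index_ne_zero_of_finite
  have hrel : (ψ.toMonoidHom.range.map (MulAut.conj δ).toMonoidHom).relIndex ψ.toMonoidHom.range ≠ 0 := by
    rw [hWδ, MonoidHom.range_eq_map ψ.toMonoidHom,
      Subgroup.relIndex_map_map_of_injective _ _ (hinjL ψ hψ), Subgroup.relIndex_top_right]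
    exact hU
  -- Thm. 3.7 (ii), second clause: `δ ∈ W`
  have hδW : δ ∈ ψ.toMonoidHom.range := by
    by_contra hδW
    have h0 := (verticialDistinct_holds (loopGraph p) h37L cL).2 PUnit.unit _ hWv 1 δ
      (by rwa [inv_one, one_mul])
    have h1 : ψ.toMonoidHom.range.map (MulAut.conj (1 : cL.G)).toMonoidHom = ψ.toMonoidHom.range := by
      apply le_antisymm
      · rintro _ ⟨y, hy, rfl⟩
        rw [MulEquiv.coe_toMonoidHom, MulAut.conj_apply, one_mul, inv_one, mul_one]
        exact hy
      · intro y hy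
        refine ⟨y, hy, ?_⟩
        rw [MulEquiv.coe_toMonoidHom, MulAut.conj_apply, one_mul, inv_one, mul_one]
    rw [h1] at h0
    exact hrel h0
  obtain ⟨d, hd⟩ := hδW
  -- `F_v = Inn(d)`
  have hVx : ∀ x, F.hV β x = d * x * d⁻¹ := fun x =>
    hinjL ψ hψ (by rw [hδ x, map_mul, map_mul, map_inv]; exact congrArg (fun t => t * ψ x * t⁻¹) hd.symm)
  -- the 2-cell of `F` at `β`: `d · b₀(u) · d⁻¹ ∈ g T₁ g⁻¹`, against the estrangement of the loop
  obtain ⟨g, hg⟩ := F.comm β β rfl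
  refine estranged_tail (V := (loopGraph p).Gv (F.base.vertexMap β))
    (T₀ := (Iw.bHom (coeff p torusBranch)).toMonoidHom.range)
    (T₁ := (Iw.bHom (coeff p (F.base.branchMap β))).toMonoidHom.range) (d := d) (g := g) ?_ ?_ ?_
  · exact fun x => loopGraph_branch_inf_conj_eq_bot p torusBranch (F.base.branchMap β) x (Or.inl hβne)
  · haveI := Iw.infinite_range_bHom (p := p) (coeff p torusBranch)
    obtain ⟨⟨a, ha⟩, ha1⟩ := exists_ne (1 : (Iw.bHom (coeff p torusBranch)).toMonoidHom.range)
    exact ⟨a, ha, fun h => ha1 (Subtype.ext h)⟩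
  · rintro _ ⟨u, rfl⟩
    have h1 := hg u
    rw [hVx] at h1
    exact ⟨_, ⟨_, rfl⟩, h1⟩

/-- **The literal step (R2) `QuasiGeometricGraphData` is FALSE as typed** (universe `0`): the fold of the
estranged Iwahori loop is quasi-geometric in the literal sense, yet admits no compatible locally open
morphism `𝒟₁ → 𝒢₁`. [cite: MochizukiSemiAnbd2006, Cor 3.9 p.42] -/
theorem not_quasiGeometricGraphData : ¬ QuasiGeometricGraphData.{0} := by
  intro hR2
  obtain ⟨cD⟩ := ExistsTemperedPiChart_holds (doubleLoop 2) (doubleLoop_prop36Hypotheses 2)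
  obtain ⟨cL⟩ := ExistsTemperedPiChart_holds (loopGraph 2) (loopGraph_prop36Hypotheses 2)
  obtain ⟨φ, hφ⟩ := exists_foldHom (torusBranch_abuts 2) cD cL
  obtain ⟨F, hF, hV, -⟩ := hR2 (doubleLoop 2) (loopGraph 2) (doubleLoop_cor39Hypotheses 2)
    (loopGraph_cor39Hypotheses 2) cD cL φ (fold_isQuasiGeometric 2 cD cL φ hφ)
  exact fold_not_compatV 2 cD cL φ hφ F hF hV

/-- **[SemiAnbd] Cor. 3.9 under the LITERAL reading of Def. 3.8 — the tree's frozen `Cor39`, FACT-LIST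
row F-1710 — is FALSE as typed** (universe `0`): clause (b) applied to the fold of the estranged Iwahori
loop yields a locally open `F` inducing it, hence ((R1) `InducesCompatible_holds`) compatible with it on
verticial homomorphisms, which `fold_not_compatV` forbids.  What fails is OUR literal typing of the
"respectively" clause of Def. 3.8 (cell finding t2g2-F1 / ruling χ2); the compatible reading is the tree's
`Cor39Compat` / `Cor39CompatUpToTwist`. [cite: MochizukiSemiAnbd2006, Cor 3.9 p.42] -/
theorem not_cor39 : ¬ Cor39.{0} := by
  intro h39
  obtain ⟨cD⟩ := ExistsTemperedPiChart_holds (doubleLoop 2) (doubleLoop_prop36Hypotheses 2)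
  obtain ⟨cL⟩ := ExistsTemperedPiChart_holds (loopGraph 2) (loopGraph_prop36Hypotheses 2)
  obtain ⟨φ, hφ⟩ := exists_foldHom (torusBranch_abuts 2) cD cL
  obtain ⟨F, hF, hind, -⟩ := (h39 (doubleLoop 2) (loopGraph 2) (doubleLoop_cor39Hypotheses 2)
    (loopGraph_cor39Hypotheses 2) cD cL).2 φ (fold_isQuasiGeometric 2 cD cL φ hφ)
  obtain ⟨hV, -⟩ := InducesCompatible_holds (doubleLoop 2) (loopGraph 2) (doubleLoop_cor39Hypotheses 2)
    (loopGraph_cor39Hypotheses 2) cD cL F φ hind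
  exact fold_not_compatV 2 cD cL φ hφ F hF hV

/-- The same refutation at every prime `p` for the pair `(doubleLoop p, loopGraph p)`: the literal Cor. 3.9
clause (b) fails THERE (a per-pair counterexample, for consumers that quote the body of `Cor39` at a pair).
[cite: MochizukiSemiAnbd2006, Cor 3.9 p.42] -/
theorem not_cor39_body_at (cD : TemperedPiChart (doubleLoop p)) (cL : TemperedPiChart (loopGraph p)) :
    ¬ ∀ φ : cD.G →ₜ* cL.G, IsQuasiGeometric φ →
        ∃ F : Hom (doubleLoop p) (loopGraph p), F.IsLocallyOpen ∧ F.Induces cD cL φ ∧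
          ∀ F' : Hom (doubleLoop p) (loopGraph p), F'.IsLocallyOpen → F'.Induces cD cL φ →
            F'.base.vertexMap = F.base.vertexMap ∧ F'.base.edgeMap = F.base.edgeMap := by
  intro hb
  obtain ⟨φ, hφ⟩ := exists_foldHom (torusBranch_abuts p) cD cL
  obtain ⟨F, hF, hind, -⟩ := hb φ (fold_isQuasiGeometric p cD cL φ hφ)
  obtain ⟨hV, -⟩ := InducesCompatible_holds (doubleLoop p) (loopGraph p) (doubleLoop_cor39Hypotheses p)
    (loopGraph_cor39Hypotheses p) cD cL F φ hind
  exact fold_not_compatV p cD cL φ hφ F hF hV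

end IwahoriWitness

end Literature.AnabelianGeometry.SemiGraphs

end
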